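import Literature.AlgebraicGeometry.Motives.AlgebraicEquivalenceFlatPullbackFiniteTypeProofs
import Literature.AlgebraicGeometry.Motives.CyclesPushforwardNormProofs
import HarnessLib

/-!
# Multiplicities of the fibre cycle of an integral family over a curve are orders of vanishing
# (Fulton, *Intersection Theory*, Example 1.5.1, local form)

For a closed subvariety `W ⊆ X ×ₖ T` over a smooth integral curve `T`, a rational point
`t ∈ T(k)` with uniformiser `π` of `𝒪_{T,t}`, and a point `w` of the fibre `W_t` over a point
`w₀ ∈ W` of codimension one, the coefficient of the fibre cycle `[W_t] ∈ Z_* X` (Fulton §10.1,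
`familyFiberCycle`) at the point of `X` under `w` is the ORDER OF VANISHING at `w₀` of the image
`a ∈ 𝒪_{W,w₀}` of `π` (Mathlib `Scheme.ord`), because the local ring of the fibre is
`𝒪_{W_t,w} = 𝒪_{W,w₀}/(a)` (`length_stalk_familyFiber_eq`) and `ord_{w₀}(a) = ℓ(𝒪_{W,w₀}/(a))`
(Fulton §1.2). This is the local content of Fulton's Example 1.5.1
("`[f⁻¹(0)] - [f⁻¹(∞)] = [div(f)]` … follows immediately from the definitions given in §1.2, §1.3
and §1.5"), the first input of Prop. 1.6 (`Rat ≤ Alg`, Example 10.3.2).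

## References

* [Fulton1998] W. Fulton, *Intersection Theory*, 2nd ed. (1998), §1.2, §1.5 (Example 1.5.1),
  §1.6, §10.1.
-/

open CategoryTheory AlgebraicGeometry Limits Order MonoidalCategory CartesianMonoidalCategory
  TopologicalSpace IsLocalRing

universe u

noncomputable section

namespace Literature.AlgebraicGeometry.Motives

variable {k : Type u} [Field k] {X T : SchemeOver k}

/-- **Fulton, Example 1.5.1 (local form): the multiplicity of the fibre cycle `[W_t]` of an
integral family `W ⊆ X ×ₖ T` at a point of codimension one is an order of vanishing.** With `w` a
point of `W_t` over `w₀ ∈ W` of codimension one, `π` a uniformiser of `𝒪_{T,t}` and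
`a ∈ 𝒪_{W,w₀}` its image (assumed non-zero): the coefficient of `[W_t]` at the point of `X`
under `w` is `ord_{w₀}(a)`. [cite: Fulton1998, Example 1.5.1] -/
theorem familyFiberCycle_apply_eq_ord (Z : ClosedSubscheme (X ⊗ T).left) [IsIntegral Z.carrier]
    (t : AlgPoints T k) (hZ : locallyFinsupp_fundamentalCycleFun.{u})
    [IsLocallyNoetherian X.left] [IsLocallyNoetherian Z.carrier]
    (w : (familyFiber Z t).carrier)
    (π : T.left.presheaf.stalk ((Z.ι ≫ (snd X T).left) (pullback.fst Z.ι (sliceAt X t).left w)))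
    (hπ : maximalIdeal _ = _root_.Ideal.span {π})
    (hco : coheight (pullback.fst Z.ι (sliceAt X t).left w) = 1)
    (ha : ((Z.ι ≫ (snd X T).left).stalkMap (pullback.fst Z.ι (sliceAt X t).left w)).hom π ≠ 0) :
    familyFiberCycle Z t hZ ((familyFiber Z t).ι w) =
      Scheme.ord (algebraMap (Z.carrier.presheaf.stalk (pullback.fst Z.ι (sliceAt X t).left w))
        Z.carrier.functionField
        (((Z.ι ≫ (snd X T).left).stalkMap (pullback.fst Z.ι (sliceAt X t).left w)).hom π))
        (pullback.fst Z.ι (sliceAt X t).left w) := by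
  -- the left-hand side is the length of the local ring of the fibre
  have hL : familyFiberCycle Z t hZ ((familyFiber Z t).ι w) =
      stalkLength (familyFiber Z t).carrier w := by
    rw [familyFiberCycle_eq, ClosedSubscheme.cycle, map_apply_of_isClosedImmersion]
    rfl
  rw [hL]
  simp only [stalkLength]
  rw [length_stalk_familyFiber_eq Z t w]
  -- `𝔪_t 𝒪_{Z,w₀} = (a)`
  have hm : (maximalIdeal _).map ((Z.ι ≫ (snd X T).left).stalkMap
      (pullback.fst Z.ι (sliceAt X t).left w)).hom =
      _root_.Ideal.span {((Z.ι ≫ (snd X T).left).stalkMap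
        (pullback.fst Z.ι (sliceAt X t).left w)).hom π} := by
    rw [hπ, Ideal.map_span, Set.image_singleton]
  refine (congrArg (fun J : _root_.Ideal _ => ((Module.length _ (_ ⧸ J)).toNat : ℤ)) hm).trans ?_
  -- the right-hand side: `ord` of a non-zero element `a` of the stalk is `ℓ(𝒪/(a))`
  haveI : Ring.KrullDimLE 1 (Z.carrier.presheaf.stalk (pullback.fst Z.ι (sliceAt X t).left w)) :=
    krullDimLE_of_coheight_le hco.le
  have hand : ((Z.ι ≫ (snd X T).left).stalkMap
      (pullback.fst Z.ι (sliceAt X t).left w)).hom π ∈ nonZeroDivisors _ :=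
    mem_nonZeroDivisors_of_ne_zero ha
  obtain ⟨n, hn⟩ := ENat.ne_top_iff_exists.mp (Ring.ord_ne_top hand)
  rw [Scheme.ord_eq_ordHom_of_coheight_eq_one hco, Scheme.ordHom, Ring.ordFrac_eq_ord _ ha,
    Ring.ordMonoidWithZeroHom_eq_coe _ hand hn.symm, WithZero.unzeroD_coe, toAdd_ofAdd]
  change ((Ring.ord _ _).toNat : ℤ) = _
  rw [← hn]
  rfl

end Literature.AlgebraicGeometry.Motives

end
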